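import Summits.BirchSwinnertonDyer.BirchSwinnertonDyer.Theorems.ManinLocalTwoThreeEvenKummerRepCongruencePeriodic
import Summits.BirchSwinnertonDyer.BirchSwinnertonDyer.Theorems.ManinLocalTwoThreeEvenKummerShimuraPosition
import HarnessLib

/-!
# With E-an-237 a THEOREM: 6b-res♮|_A is FREE modulo print, 6b-res / 6b‴ / E-an-53|₄ ⟸ E-an-152 ∧ E-an-152b, and the C2 v25/v26 stubs 6b-res|_B / 6b-res|_G
# ⟸ E-an-152|_B ∧ E-an-152b|_B ∧ F★ ∧ F♮ ∧ CES (route `ManinLocalTwoThree`, crux C2 `ManinOddAtFour` stmt-BirchSwinnertonDyer-22967; cell bsd-f2-manin, p2 gen 20)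

-an g42's companion `…EvenKummerShimuraPosition` (p1 p748683) proves everything MODULO `h237 : EvenKummerRepCongruencePeriodic`; p2 g20's
`EvenKummerCongruence.evenKummerRepCongruencePeriodic_holds` (p749642) discharges that binder.  By name:
* §1 `false_of_allEven_of_modularSymbol_zero_mem_of_print` / `…_of_rootNumber_eq_neg_one_of_print` — on locus A (`{∞,0}_f ∈ Λ₀(f)` ⊇ root number −1),
  NO rational `2`-torsion point has an all-even cuspidal Kummer representative, modulo F★ ∧ F♮ ∧ CES only;
  **6b-res♮|_A `CuspidalKummerEvenExponentSquareAtCuspZero` HOLDS modulo F★ ∧ F♮ ∧ CES** (`cuspidalKummerEvenExponentSquareAtCuspZero_of_print`);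
* §2 6b-res♮ `CuspidalKummerEvenExponentSquare`, 6b-res `…OnCore`, 6b‴ `CuspidalKummerOddExponentOnCore`, E-an-53|₄ `CuspidalKummerOddExponent`
  ⟸ E-an-152 `ShimuraKernelBlindAtFour` ∧ E-an-152b `ShimuraIndexNeFourAtFour` (no print, no E-an-237);
* §3 6b-res, the v25 stub 6b-res|_B `CuspidalKummerEvenExponentSquareOnCoreB` and the REGISTERED v26 stub shape 6b-res|_G
  (`cuspidalKummerEvenExponentSquareOnCoreG_of_B_rows_of_print`, binders `{∞,0}_f ∉ Λ₀` and `Λ₁ ≠ Λ₀`) ⟸ E-an-152|_B ∧ E-an-152b|_B ∧ F★ ∧ F♮ ∧ CES;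
* §4 `le_kummerLineTwo_of_allEven'` — an all-even representative puts `T` in the Shimura `2`-kernel (`Λ₁(f) ⊆ ℤ·(2p/c) + 2Λ₀(f)`), unconditionally
  for lattice-optimal data.
HONEST FRAMING: E-an-152, E-an-152b (Stevens-curve rows), F★, F♮, CES (printed, statement-only), C2 `ManinOddAtFour`, C3, Manin's conjecture remain OPEN;
BSD is not proved by this.  No definitions, no sorry. [cite: Stevens1989, §2] [cite: ConradEdixhovenStein2003, Thm. 1.1.3] [cite: AtkinLehner1970, Thm. 3]
-/

set_option autoImplicit false
-- lint-debt: the directory name repeats the summit name (sibling precedent `ManinLocalTwoThreeEvenKummerShimuraPosition.lean`)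
set_option linter.dupNamespace false

noncomputable section

open scoped PeriodPair MatrixGroups ModularForm NumberField
open Complex PowerSeries CongruenceSubgroup
open IsDedekindDomain IsDedekindDomain.HeightOneSpectrum Rat.HeightOneSpectrum
open WeierstrassCurve Literature.NumberTheory.EllipticCurves Literature.NumberTheory.EllipticCurves.ModularForms
open Summit.BirchSwinnertonDyer.Rank1Residual.ManinAdditive.CuspidalKummer
open Summit.BirchSwinnertonDyer.Rank1Residual.ManinAdditive.ShimuraKernel
open Summit.BirchSwinnertonDyer.Rank1Residual.ManinAdditive.KummerShimuraTwo
open Summit.BirchSwinnertonDyer.BirchSwinnertonDyer.Theorems.ManinLocalTwoThree.SigmaSquareRoot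

namespace Summit.BirchSwinnertonDyer.BirchSwinnertonDyer.Theorems.ManinLocalTwoThree.EvenKummerCongruence

/-! ## §1 Locus A: no all-even representative, 6b-res♮|_A free — modulo print only -/

section LocusA

variable {W : WeierstrassCurve ℚ} [W.IsElliptic] [W.IsGloballyMinimal] {N : ℕ} [NeZero N]

/-- **On locus A there is NO all-even cuspidal Kummer representative**, modulo F★ ∧ F♮ ∧ CES (E-an-237 discharged by p749642).
[cite: Stevens1989, §2] [cite: ConradEdixhovenStein2003, Thm. 1.1.3] -/
theorem false_of_allEven_of_modularSymbol_zero_mem_of_print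
    (hF : optimalGamma1Parametrization_cusp_rational) (hFnat : optimalGamma1Parametrization_cuspZero_galoisConjugate)
    (hCES : exists_optimal_gamma1ParametrizationData)
    (D : ModularParametrizationData W N) (a : ℕ → ℤ) (ha : ∀ n, (a n : ℂ) = cuspCoeff D.f n)
    (hopt : ∀ z ∈ D.L.lattice, ∃ w ∈ periodLattice D.f, z = D.c * w)
    (h0 : modularSymbol D.f 0 ∈ periodLattice D.f)
    {e : ℤ} (he : W.twoTorsionPolynomial.toPoly.IsRoot (e : ℚ)) {z : ℚ⟦X⟧} (hz : IsParamGerm W D.c a z)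
    {r : ℕ → ℤ} {g A B : ℤ⟦X⟧} (hrep : IsCuspidalKummerRep N (kummerSeries W D.c ((e : ℚ)) z) r g A B)
    (hev : ∀ δ ∈ N.divisors, Even (r δ)) : False :=
  Summit.BirchSwinnertonDyer.Rank1Residual.ManinAdditive.KummerShimuraTwo.false_of_allEven_of_modularSymbol_zero_mem_of_print
    evenKummerRepCongruencePeriodic_holds hF hFnat hCES D a ha
    hopt h0 he hz hrep hev

/-- **Root number `−1` ⟹ no all-even cuspidal Kummer representative** (conductor level), modulo F★ ∧ F♮ ∧ CES.
[cite: AtkinLehner1970, Thm. 3] [cite: Stevens1989, §2] -/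
theorem false_of_allEven_of_rootNumber_eq_neg_one_of_print [NeZero (W.conductorNorm ℤ)]
    (hF : optimalGamma1Parametrization_cusp_rational) (hFnat : optimalGamma1Parametrization_cuspZero_galoisConjugate)
    (hCES : exists_optimal_gamma1ParametrizationData)
    (D : ModularParametrizationData W (W.conductorNorm ℤ)) (a : ℕ → ℤ) (ha : ∀ n, (a n : ℂ) = cuspCoeff D.f n)
    (hopt : ∀ z ∈ D.L.lattice, ∃ w ∈ periodLattice D.f, z = D.c * w) (hw : W.rootNumber = -1)
    {e : ℤ} (he : W.twoTorsionPolynomial.toPoly.IsRoot (e : ℚ)) {z : ℚ⟦X⟧} (hz : IsParamGerm W D.c a z)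
    {r : ℕ → ℤ} {g A B : ℤ⟦X⟧} (hrep : IsCuspidalKummerRep (W.conductorNorm ℤ) (kummerSeries W D.c ((e : ℚ)) z) r g A B)
    (hev : ∀ δ ∈ (W.conductorNorm ℤ).divisors, Even (r δ)) : False :=
  Summit.BirchSwinnertonDyer.Rank1Residual.ManinAdditive.KummerShimuraTwo.false_of_allEven_of_rootNumber_eq_neg_one_of_print
    evenKummerRepCongruencePeriodic_holds hF hFnat hCES D a ha
    hopt hw he hz hrep hev

end LocusA

/-- **6b-res♮|_A `CuspidalKummerEvenExponentSquareAtCuspZero` HOLDS modulo F★ ∧ F♮ ∧ CES** (printed, statement-only). [cite: Stevens1989, §2]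
[cite: ConradEdixhovenStein2003, Thm. 1.1.3] -/
theorem cuspidalKummerEvenExponentSquareAtCuspZero_of_print
    (hF : optimalGamma1Parametrization_cusp_rational) (hFnat : optimalGamma1Parametrization_cuspZero_galoisConjugate)
    (hCES : exists_optimal_gamma1ParametrizationData) : CuspidalKummerEvenExponentSquareAtCuspZero :=
  cuspidalKummerEvenExponentSquareAtCuspZero_of_congruencePeriodic_of_print evenKummerRepCongruencePeriodic_holds hF hFnat hCES

/-! ## §2 6b-res♮ / 6b-res / 6b‴ / E-an-53|₄ ⟸ E-an-152 ∧ E-an-152b -/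

/-- **6b-res♮ `CuspidalKummerEvenExponentSquare` ⟸ E-an-152 ∧ E-an-152b** (Stevens-curve rows; E-an-237 discharged). [cite: Stevens1989, §2] -/
theorem cuspidalKummerEvenExponentSquare_of_kernelRows (h152 : ShimuraKernelBlindAtFour) (h152b : ShimuraIndexNeFourAtFour) :
    CuspidalKummerEvenExponentSquare :=
  cuspidalKummerEvenExponentSquare_of_congruencePeriodic_of_kernelRows evenKummerRepCongruencePeriodic_holds h152 h152b

/-- **6b-res `CuspidalKummerEvenExponentSquareOnCore` ⟸ E-an-152 ∧ E-an-152b.** [cite: Stevens1989, §2] -/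
theorem cuspidalKummerEvenExponentSquareOnCore_of_kernelRows (h152 : ShimuraKernelBlindAtFour) (h152b : ShimuraIndexNeFourAtFour) :
    CuspidalKummerEvenExponentSquareOnCore :=
  cuspidalKummerEvenExponentSquareOnCore_of_congruencePeriodic_of_kernelRows evenKummerRepCongruencePeriodic_holds h152 h152b

/-- **6b‴ `CuspidalKummerOddExponentOnCore` ⟸ E-an-152 ∧ E-an-152b.** [cite: Stevens1989, §2] -/
theorem cuspidalKummerOddExponentOnCore_of_kernelRows (h152 : ShimuraKernelBlindAtFour) (h152b : ShimuraIndexNeFourAtFour) :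
    CuspidalKummerOddExponentOnCore :=
  cuspidalKummerOddExponentOnCore_of_congruencePeriodic_of_kernelRows evenKummerRepCongruencePeriodic_holds h152 h152b

/-- **E-an-53|₄ `CuspidalKummerOddExponent` ⟸ E-an-152 ∧ E-an-152b.** [cite: Stevens1989, §2] -/
theorem cuspidalKummerOddExponent_of_kernelRows (h152 : ShimuraKernelBlindAtFour) (h152b : ShimuraIndexNeFourAtFour) :
    CuspidalKummerOddExponent :=
  cuspidalKummerOddExponent_of_congruencePeriodic_of_kernelRows evenKummerRepCongruencePeriodic_holds h152 h152b

/-! ## §3 The B- and G-restricted stubs ⟸ E-an-152|_B ∧ E-an-152b|_B ∧ print -/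

/-- **6b-res ⟸ 6b-res|_B modulo F★ ∧ F♮ ∧ CES** (locus A is free). [cite: Stevens1989, §2] -/
theorem cuspidalKummerEvenExponentSquareOnCore_of_B_of_print
    (hF : optimalGamma1Parametrization_cusp_rational) (hFnat : optimalGamma1Parametrization_cuspZero_galoisConjugate)
    (hCES : exists_optimal_gamma1ParametrizationData) (h : CuspidalKummerEvenExponentSquareOnCoreB) :
    CuspidalKummerEvenExponentSquareOnCore :=
  cuspidalKummerEvenExponentSquareOnCore_of_B_of_congruencePeriodic_of_print evenKummerRepCongruencePeriodic_holds hF hFnat hCES h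

/-- **6b-res ⟸ E-an-152|_B ∧ E-an-152b|_B ∧ F★ ∧ F♮ ∧ CES.** [cite: Stevens1989, §2] [cite: ConradEdixhovenStein2003, Thm. 1.1.3] -/
theorem cuspidalKummerEvenExponentSquareOnCore_of_B_rows_of_print
    (hF : optimalGamma1Parametrization_cusp_rational) (hFnat : optimalGamma1Parametrization_cuspZero_galoisConjugate)
    (hCES : exists_optimal_gamma1ParametrizationData) (h152 : ShimuraKernelBlindAtFourB) (h152b : ShimuraIndexNeFourAtFourB) :
    CuspidalKummerEvenExponentSquareOnCore :=
  cuspidalKummerEvenExponentSquareOnCore_of_congruencePeriodic_of_B_of_print evenKummerRepCongruencePeriodic_holds hF hFnat hCES h152 h152b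

/-- **The C2 v25 stub 6b-res|_B `CuspidalKummerEvenExponentSquareOnCoreB` ⟸ E-an-152|_B ∧ E-an-152b|_B ∧ F★ ∧ F♮ ∧ CES.** [cite: Stevens1989, §2] -/
theorem cuspidalKummerEvenExponentSquareOnCoreB_of_B_rows_of_print
    (hF : optimalGamma1Parametrization_cusp_rational) (hFnat : optimalGamma1Parametrization_cuspZero_galoisConjugate)
    (hCES : exists_optimal_gamma1ParametrizationData) (h152 : ShimuraKernelBlindAtFourB) (h152b : ShimuraIndexNeFourAtFourB) :
    CuspidalKummerEvenExponentSquareOnCoreB :=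
  cuspidalKummerEvenExponentSquareOnCoreB_of_congruencePeriodic_of_B_of_print evenKummerRepCongruencePeriodic_holds hF hFnat hCES h152 h152b

/-- **The REGISTERED C2 v26 stub shape 6b-res|_G (`Lines/kato_shift_two.lean`, `stub_cuspidalKummerEvenExponentSquareOnCoreG`: 6b-res|_B with the extra binder
`Λ₁(f) ≠ Λ₀(f)`) ⟸ E-an-152|_B ∧ E-an-152b|_B ∧ F★ ∧ F♮ ∧ CES** — the gain-locus binder is simply dropped. [cite: Stevens1989, §2] -/
theorem cuspidalKummerEvenExponentSquareOnCoreG_of_B_rows_of_print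
    (hF : optimalGamma1Parametrization_cusp_rational) (hFnat : optimalGamma1Parametrization_cuspZero_galoisConjugate)
    (hCES : exists_optimal_gamma1ParametrizationData) (h152 : ShimuraKernelBlindAtFourB) (h152b : ShimuraIndexNeFourAtFourB) :
    ∀ (W : WeierstrassCurve ℚ) [W.IsElliptic] [W.IsGloballyMinimal] {N : ℕ} [NeZero N]
      (D : ModularParametrizationData W N) (a : ℕ → ℤ), (∀ n, (a n : ℂ) = cuspCoeff D.f n) →
      2 ^ 4 ∣ N → (∀ z ∈ D.L.lattice, ∃ w ∈ periodLattice D.f, z = D.c * w) →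
      ((primesEquiv (R := 𝓞 ℚ)).symm ⟨2, Nat.prime_two⟩).valuation ℚ W.j < 1 →
      (∀ d : ℤ, d = -1 ∨ d = 2 ∨ d = -2 → 2 ≤ (W.quadraticTwist (d : ℚ)).conductorExponent ((primesEquiv (R := ℤ)).symm ⟨2, Nat.prime_two⟩)) →
      modularSymbol D.f 0 ∉ periodLattice D.f → periodLatticeGamma1 D.f ≠ periodLattice D.f →
      ∀ (a₂ a₄ e : ℤ), W.a₁ = 0 → W.a₃ = 0 → W.a₂ = a₂ → W.a₄ = a₄ →
      W.twoTorsionPolynomial.toPoly.IsRoot (e : ℚ) → ¬ KummerBlindAtTwo a₂ a₄ e →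
      ∀ z : ℚ⟦X⟧, IsParamGerm W D.c a z →
      ∀ (r : ℕ → ℤ) (g A B : ℤ⟦X⟧), IsCuspidalKummerRep N (kummerSeries W D.c ((e : ℚ)) z) r g A B →
      (∀ δ ∈ N.divisors, Even (r δ)) → IsSquare (∏ δ ∈ N.divisors, δ ^ (r δ / 2).natAbs) :=
  fun W _ _ _N _ D a ha h16 hLat hj hcore h0 _hG ↦
    cuspidalKummerEvenExponentSquareOnCoreB_of_B_rows_of_print hF hFnat hCES h152 h152b W D a ha h16 hLat hj hcore h0

/-! ## §4 Position: an all-even representative puts `T` in the Shimura `2`-kernel -/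

/-- **An all-even cuspidal Kummer representative puts `T` in the Shimura `2`-kernel** — `Λ₁(f) ⊆ ℤ·(2p/c) + 2Λ₀(f)` for every half-period `p` of `T`
(lattice-optimal datum, any level; E-an-237 discharged). [cite: Stevens1989, §2] -/
theorem le_kummerLineTwo_of_allEven' {W : WeierstrassCurve ℚ} [W.IsElliptic] [W.IsGloballyMinimal] {N : ℕ} [NeZero N]
    (D : ModularParametrizationData W N) (a : ℕ → ℤ) (ha : ∀ n, (a n : ℂ) = cuspCoeff D.f n)
    (hopt : ∀ z ∈ D.L.lattice, ∃ w ∈ periodLattice D.f, z = D.c * w)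
    {e : ℤ} (he : W.twoTorsionPolynomial.toPoly.IsRoot (e : ℚ)) {z : ℚ⟦X⟧} (hz : IsParamGerm W D.c a z)
    {r : ℕ → ℤ} {g A B : ℤ⟦X⟧} (hrep : IsCuspidalKummerRep N (kummerSeries W D.c ((e : ℚ)) z) r g A B)
    (hev : ∀ δ ∈ N.divisors, Even (r δ)) {p : ℂ} {m₁ m₂ : ℤ} (hp : p ∉ D.L.lattice)
    (h2p : 2 * p = m₁ * D.L.ω₁ + m₂ * D.L.ω₂) (h℘ : ℘[D.L] p = ((e : ℚ) : ℂ) + (W.b₂ : ℂ) / 12) :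
    ∀ x ∈ periodLatticeGamma1 D.f, ∃ k : ℤ, ∃ v ∈ periodLattice D.f, x = k * (2 * p / D.c) + 2 * v :=
  le_kummerLineTwo_of_allEven evenKummerRepCongruencePeriodic_holds D a ha hopt he hz hrep hev hp h2p h℘

end Summit.BirchSwinnertonDyer.BirchSwinnertonDyer.Theorems.ManinLocalTwoThree.EvenKummerCongruence

end
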